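import Summits.CriticalPhenomena.PercolationContinuityZ3.Theorems.Transplant.SkelPhiStepINegO
import Literature.Probability.Percolation.PlacedBricks
import Literature.Probability.Percolation.HalfSpaceBrickSymmetry
import HarnessLib

/-!
# N2 (frames-only node, OPEN), LEVEL 0‴ of the ORIENTED route design (N2-SCOPE §17 (R-12) FINAL; typed p3-g13, filed p3-g14): **the REFLECTED dictionary map `reflφ s φ = (s₀φ₀, s₁φ₁)`** (twin of `trφ`) and
# the SET-LEVEL COVARIANCE of the equilibrium pieces (N2-SCOPE v1.2 (R-10)): `Lip/Steps/Frames/CylConn/CylSubcritical` transport, `cyl/cylBall/cylReach` are invariant,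
# `pgramCyl/pgramPrism` are invariant under `h ↦ s₀s₁h`, and
# `pgSideHalfW (reflφ s φ) … (s₀s₁h) … (s₀σ) (s₁τ) = pgSideHalfW φ … h … σ τ`, `pgTopPieceW (reflφ s φ) … (s₀s₁h) … (s₁σ) (s₀s₁τ) (s₀s₁v) = pgTopPieceW φ … h … σ τ v`.
So a Step-I‴ record TRANSPORTS to the flipped chart with `hgt, spl ↦ s₀s₁·` and equal link events — the global flip of (R-2) never re-runs Step I‴.
builds on p205010 (kernel theorem, internal audit signed; external expert review pending) — nothing here uses p205010; nothing is claimed about any node. [this work]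
-/

noncomputable section

namespace Summit.CriticalPhenomena.PercolationContinuityZ3.Theorems.Transplant

namespace Skelφ

open MeasureTheory Literature.Probability.Percolation Literature.Probability.LatticeModels SimpleGraph KNLevels
open Literature.Barriers.CriticalPhenomena (graphBall)
open scoped Classical

variable {V : Type} {G : SimpleGraph V}

/-! ## §1 The reflected dictionary map -/

/-- The coordinate-reflected chart `(s₀φ₀, s₁φ₁)`. [this work] -/
def reflφ (s : Fin 2 → ℤˣ) (φ : V → Site 2) : V → Site 2 := fun w i => (s i : ℤ) * φ w i

/-- `reflφ` unfolded. [folklore] -/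
@[simp] theorem reflφ_apply (s : Fin 2 → ℤˣ) (φ : V → Site 2) (w : V) (i : Fin 2) : reflφ s φ w i = (s i : ℤ) * φ w i := rfl

/-- Relative coordinates of the reflected chart. [folklore] -/
theorem relCoord_reflφ (s : Fin 2 → ℤˣ) (φ : V → Site 2) (t : V) (i : Fin 2) (w : V) :
    relCoord (reflφ s φ) t i w = (s i : ℤ) * relCoord φ t i w := by
  simp only [relCoord_apply, reflφ_apply]; ring

/-- The sheared coordinate of the reflected chart at the reflected shear `s₀s₁h`: `s₁ · β′`. [this work] -/
theorem shearCoord_reflφ (s : Fin 2 → ℤˣ) (φ : V → Site 2) (t : V) (n : ℕ) (h : ℤ) (w : V) :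
    shearCoord (reflφ s φ) t n ((s 0 : ℤ) * (s 1 : ℤ) * h) w = (s 1 : ℤ) * shearCoord φ t n h w := by
  simp only [shearCoord_apply, reflφ_apply]
  have h0 := BGN.units_mul_self (s 0)
  calc (n : ℤ) * ((s 1 : ℤ) * φ w 1 - (s 1 : ℤ) * φ t 1) - (s 0 : ℤ) * (s 1 : ℤ) * h * ((s 0 : ℤ) * φ w 0 - (s 0 : ℤ) * φ t 0)
      = (s 1 : ℤ) * ((n : ℤ) * (φ w 1 - φ t 1)) - (s 1 : ℤ) * (((s 0 : ℤ) * s 0) * (h * (φ w 0 - φ t 0))) := by ring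
    _ = (s 1 : ℤ) * ((n : ℤ) * (φ w 1 - φ t 1) - h * (φ w 0 - φ t 0)) := by rw [h0, one_mul]; ring

/-- The reflected shear has the same absolute value. [folklore] -/
theorem natAbs_reflHgt (s : Fin 2 → ℤˣ) (h : ℤ) : ((s 0 : ℤ) * (s 1 : ℤ) * h).natAbs = h.natAbs := by
  rcases Int.units_eq_one_or (s 0) with h0 | h0 <;> rcases Int.units_eq_one_or (s 1) with h1 | h1 <;> simp [h0, h1]

/-- A planar vector lies in the box iff its reflection does. [folklore] -/
theorem sub_mem_box_reflφ (s : Fin 2 → ℤˣ) (φ : V → Site 2) (t w : V) (ℓ : ℕ) : reflφ s φ w - reflφ s φ t ∈ box 2 ℓ ↔ φ w - φ t ∈ box 2 ℓ := by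
  simp only [mem_box, Pi.sub_apply, reflφ_apply]
  refine forall_congr' fun i => ?_
  rw [← mul_sub, ← abs_le, ← abs_le, BGN.abs_units_mul]

/-- Cylinders are reflection-invariant. [folklore] -/
theorem cyl_reflφ (s : Fin 2 → ℤˣ) (φ : V → Site 2) (t : V) (ℓ : ℕ) : cyl (reflφ s φ) t ℓ = cyl φ t ℓ := by
  ext w; rw [mem_cyl, mem_cyl, sub_mem_box_reflφ]

/-- `Lip` is reflection-invariant. [folklore] -/
theorem lip_reflφ (s : Fin 2 → ℤˣ) {φ : V → Site 2} (h : Lip G φ) : Lip G (reflφ s φ) := fun _ _ huv i => by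
  rw [reflφ_apply, reflφ_apply, ← mul_sub, BGN.abs_units_mul]; exact h huv i

/-- `Steps` is reflection-invariant (the step of sign `σ` in the reflected chart is the step of sign `σ·sᵢ`). [folklore] -/
theorem steps_reflφ (s : Fin 2 → ℤˣ) {φ : V → Site 2} (h : Steps G φ) : Steps G (reflφ s φ) := by
  intro v i σ
  obtain ⟨v', hadj, hφ⟩ := h v i (σ * s i)
  refine ⟨v', hadj, funext fun j => ?_⟩
  rw [reflφ_apply, Pi.add_apply, reflφ_apply, hφ, Pi.add_apply, mul_add]
  congr 1
  by_cases hj : j = i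
  · subst hj
    rw [Pi.single_eq_same, Pi.single_eq_same, Units.val_mul]
    have := BGN.units_mul_self (s j)
    calc (s j : ℤ) * (σ * s j) = σ * ((s j : ℤ) * s j) := by ring
      _ = σ := by rw [this, mul_one]
  · rw [Pi.single_eq_of_ne hj, Pi.single_eq_of_ne hj, mul_zero]

/-- `Frames` is reflection-invariant. [folklore] -/
theorem frames_reflφ (s : Fin 2 → ℤˣ) {φ : V → Site 2} {types : Finset V} (h : Frames G φ types) : Frames G (reflφ s φ) types := by
  intro v
  obtain ⟨t, ht, α, hαt, hφ⟩ := h v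
  exact ⟨t, ht, α, hαt, fun w => funext fun i => by simp only [reflφ_apply, hφ w, Pi.add_apply, Pi.sub_apply]; ring⟩

/-- `CylConn` is reflection-invariant. [folklore] -/
theorem cylConn_reflφ (s : Fin 2 → ℤˣ) {φ : V → Site 2} {types : Finset V} (h : CylConn G φ types) : CylConn G (reflφ s φ) types := by
  intro t ht ℓ hℓ
  have e : {w | reflφ s φ w - reflφ s φ t ∈ box 2 ℓ} = {w | φ w - φ t ∈ box 2 ℓ} := by ext w; exact sub_mem_box_reflφ s φ t w ℓ
  rw [e]; exact h t ht ℓ hℓ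

/-- `CylSubcritical` (Φ2) is reflection-invariant. [folklore] -/
theorem cylSubcritical_reflφ [Countable V] [G.LocallyFinite] (s : Fin 2 → ℤˣ) {φ : V → Site 2} {types : Finset V} {p : unitInterval}
    (h : CylSubcritical G φ types p) : CylSubcritical G (reflφ s φ) types p := by
  intro t ht ℓ
  have key : ∀ (S : Set V) (hS : S = cyl φ t ℓ) (ht' : t ∈ S), theta (G.induce S) ⟨t, ht'⟩ p = 0 := by
    intro S hS ht'; subst hS; exact h t ht ℓ
  exact key _ (cyl_reflφ s φ t ℓ) _

/-! ## §2 Fat balls, tails, parallelograms: invariant -/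

section Balls

variable [G.LocallyFinite]

/-- Fat balls are reflection-invariant. [folklore] -/
theorem cylBall_reflφ (s : Fin 2 → ℤˣ) (φ : V → Site 2) (t : V) (ℓ R : ℕ) : cylBall G (reflφ s φ) t ℓ R = cylBall G φ t ℓ R :=
  image_graphBall_induce_congr (cyl_reflφ s φ t ℓ) t _ _ R

/-- Far sets are reflection-invariant. [folklore] -/
theorem cylFar_reflφ (s : Fin 2 → ℤˣ) (φ : V → Site 2) (t : V) (n R : ℕ) : cylFar G (reflφ s φ) t n R = cylFar G φ t n R := by
  ext v; simp only [cylFar, Set.mem_setOf_eq, cylBall_reflφ]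

/-- Cylinder tails are reflection-invariant. [folklore] -/
theorem cylReach_reflφ (s : Fin 2 → ℤˣ) (φ : V → Site 2) (t : V) (n R : ℕ) (a : V) : cylReach G (reflφ s φ) t n R a = cylReach G φ t n R a := by
  ext ω; simp only [cylReach, Set.mem_setOf_eq, cylFar_reflφ, cyl_reflφ]

end Balls

/-- The parallelogram cylinder is reflection-invariant under `h ↦ s₀s₁h`. [this work] -/
theorem pgramCyl_reflφ (s : Fin 2 → ℤˣ) (φ : V → Site 2) (t : V) (n : ℕ) (h : ℤ) (ℓ : ℕ) :
    pgramCyl (reflφ s φ) t n ((s 0 : ℤ) * (s 1 : ℤ) * h) ℓ = pgramCyl φ t n h ℓ := by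
  ext w
  rw [mem_pgramCyl, mem_pgramCyl, relCoord_reflφ, shearCoord_reflφ, BGN.abs_units_mul, BGN.abs_units_mul]

/-- The planar scale is invariant under `h ↦ s₀s₁h`. [folklore] -/
theorem pgScale_reflHgt (s : Fin 2 → ℤˣ) (n : ℕ) (h : ℤ) (ℓ : ℕ) : pgScale n ((s 0 : ℤ) * (s 1 : ℤ) * h) ℓ = pgScale n h ℓ := by
  unfold pgScale; rw [natAbs_reflHgt]

/-- The fat parallelogram (link region) is reflection-invariant under `h ↦ s₀s₁h`. [this work] -/
theorem pgramPrism_reflφ [G.LocallyFinite] (s : Fin 2 → ℤˣ) (φ : V → Site 2) (t : V) (n : ℕ) (h : ℤ) (ℓ R : ℕ) :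
    pgramPrism G (reflφ s φ) t n ((s 0 : ℤ) * (s 1 : ℤ) * h) ℓ R = pgramPrism G φ t n h ℓ R := by
  ext w
  rw [mem_pgramPrism, mem_pgramPrism, pgramCyl_reflφ, pgScale_reflHgt, cylBall_reflφ]

/-! ## §3 Covariance of the equilibrium pieces -/

/-- **The side half `(σ, τ)` of `φ` is the side half `(s₀σ, s₁τ)` of the reflected chart** (at shear `s₀s₁h`). [this work] -/
theorem pgSideHalfW_reflφ [G.LocallyFinite] (s : Fin 2 → ℤˣ) (φ : V → Site 2) (t : V) (n : ℕ) (h : ℤ) (ℓ R : ℕ) (σ τ : ℤ) :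
    pgSideHalfW G (reflφ s φ) t n ((s 0 : ℤ) * (s 1 : ℤ) * h) ℓ R ((s 0 : ℤ) * σ) ((s 1 : ℤ) * τ) = pgSideHalfW G φ t n h ℓ R σ τ := by
  ext w
  rw [mem_pgSideHalfW, mem_pgSideHalfW, pgramPrism_reflφ, pgramCyl_reflφ, relCoord_reflφ, shearCoord_reflφ]
  have h0 := BGN.units_mul_self (s 0); have h1 := BGN.units_mul_self (s 1)
  have e0 : ((s 0 : ℤ) * relCoord φ t 0 w = (s 0 : ℤ) * σ * n) ↔ relCoord φ t 0 w = σ * n := by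
    constructor
    · intro e
      calc relCoord φ t 0 w = ((s 0 : ℤ) * s 0) * relCoord φ t 0 w := by rw [h0, one_mul]
        _ = (s 0 : ℤ) * ((s 0 : ℤ) * relCoord φ t 0 w) := by ring
        _ = (s 0 : ℤ) * ((s 0 : ℤ) * σ * n) := by rw [e]
        _ = ((s 0 : ℤ) * s 0) * (σ * n) := by ring
        _ = σ * n := by rw [h0, one_mul]
    · intro e; rw [e]; ring
  have e1 : (0 ≤ (s 1 : ℤ) * τ * ((s 1 : ℤ) * shearCoord φ t n h w)) ↔ 0 ≤ τ * shearCoord φ t n h w := by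
    have : (s 1 : ℤ) * τ * ((s 1 : ℤ) * shearCoord φ t n h w) = ((s 1 : ℤ) * s 1) * (τ * shearCoord φ t n h w) := by ring
    rw [this, h1, one_mul]
  rw [e0, e1]

/-- **The top piece `(σ, τ, v)` of `φ` is the top piece `(s₁σ, s₀s₁τ, s₀s₁v)` of the reflected chart** (at shear `s₀s₁h`). [this work] -/
theorem pgTopPieceW_reflφ [G.LocallyFinite] (s : Fin 2 → ℤˣ) (φ : V → Site 2) (t : V) (n : ℕ) (h : ℤ) (ℓ R : ℕ) (σ τ v : ℤ) :
    pgTopPieceW G (reflφ s φ) t n ((s 0 : ℤ) * (s 1 : ℤ) * h) ℓ R ((s 1 : ℤ) * σ) ((s 0 : ℤ) * (s 1 : ℤ) * τ) ((s 0 : ℤ) * (s 1 : ℤ) * v) =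
      pgTopPieceW G φ t n h ℓ R σ τ v := by
  ext w
  rw [mem_pgTopPieceW, mem_pgTopPieceW, pgramPrism_reflφ, pgramCyl_reflφ, relCoord_reflφ, shearCoord_reflφ, natAbs_reflHgt]
  have h0 := BGN.units_mul_self (s 0); have h1 := BGN.units_mul_self (s 1)
  have e1 : (s 1 : ℤ) * σ * ((s 1 : ℤ) * shearCoord φ t n h w) = σ * shearCoord φ t n h w := by
    calc (s 1 : ℤ) * σ * ((s 1 : ℤ) * shearCoord φ t n h w) = ((s 1 : ℤ) * s 1) * (σ * shearCoord φ t n h w) := by ring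
      _ = _ := by rw [h1, one_mul]
  have e2 : (s 0 : ℤ) * (s 1 : ℤ) * τ * ((s 1 : ℤ) * σ * ((s 0 : ℤ) * relCoord φ t 0 w) - (s 0 : ℤ) * (s 1 : ℤ) * v) =
      τ * (σ * relCoord φ t 0 w - v) := by
    calc (s 0 : ℤ) * (s 1 : ℤ) * τ * ((s 1 : ℤ) * σ * ((s 0 : ℤ) * relCoord φ t 0 w) - (s 0 : ℤ) * (s 1 : ℤ) * v)
        = (((s 0 : ℤ) * s 0) * ((s 1 : ℤ) * s 1)) * (τ * (σ * relCoord φ t 0 w - v)) := by ring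
      _ = _ := by rw [h0, h1, one_mul, one_mul]
  rw [e1, e2]

end Skelφ

end Summit.CriticalPhenomena.PercolationContinuityZ3.Theorems.Transplant

end
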